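import Literature.NumberTheory.LFunctions.DobnerSelbergClass
import Literature.Analysis.SpecialFunctions.GammaStirlingVertical
import HarnessLib

/-!
# Dobner's Lemma 1 (Stirling-type two-sided bound for the gamma factor of `𝒮♯`) — the discharge

RH-FREE literature proof. Trunk T-ANT (`Literature/NumberTheory/LFunctions`); companion of
`DobnerSelbergClass.lean`, where `Literature.NumberTheory.LFunctions.dobner_lemma1` is the named
fact (A. Dobner, *A proof of Newman's conjecture for the extended Selberg class*, Acta Arith. 201
(2021) = arXiv:2005.05142, **Lemma 1**, p. 5; proof §5, p. 15 of the held arXiv text):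
for `γ(s) = α sᵐ(s−1)ᵐ Qˢ ∏ᵢ Γ(ωᵢ s + μᵢ)` (`α ≠ 0`, `Q > 0`, `k ≥ 1`, `ωᵢ > 0`), `D > 0` and
`0 ≤ θ < 1` there are `K, K', T₀ > 0` with `exp(−K'|Im s|) ≤ |γ(s)| ≤ exp(−K|Im s|)` whenever
`|Re s| ≤ D|Im s|^θ` and `|Im s| ≥ T₀`.

## Proof (following the source, p. 15, with explicit errors)

Stirling for one factor: for `Re w > 0` the tree's uniform Stirling formula
`Literature.Analysis.SpecialFunctions.GammaStirling.abs_log_norm_Gamma_sub_le` and the argument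
bound `GammaStirling.pi_mul_abs_div_two_sub_im_mul_arg_mem` give
`log |Γ(w)| = −π|Im w|/2 + O((Re w + 1) log |w|)` (Step A); the recurrence
`|Γ(w)| = |Γ(w+n)|/∏|w+j|` (`GammaStirling.norm_Gamma_eq_norm_Gamma_add_nat_div`) extends this
to all real parts (Step B), hence in a region `|Re w| ≤ X ≤ |Im w|`:
`|log |Γ(w)| + π|Im w|/2| ≤ 18(X+1) log |Im w|` (Step C). For `w = ωᵢ s + μᵢ`,
`|Re s| ≤ D|Im s|^θ`: `log |Γ(ωᵢ s + μᵢ)| = −(π/2)ωᵢ|Im s| + o(|Im s|)` uniformly (Step D); the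
polynomial and exponential factors are `exp(o(|Im s|))` (Step E); so
`log |γ(s)| = −W|Im s| + o(|Im s|)`, `W = (π/2)∑ωᵢ > 0`, and `K = W/2`, `K' = 3W/2` work
(`dobner_lemma1_holds`). The printed hypothesis `Re μᵢ ≥ 0` is not needed for large `|Im s|`.

bears_on: N-C/N-P (COLUMN 3 DBN). WHAT THIS IS NOT: nothing here bears on the truth of RH.

## References

* A. Dobner, arXiv:2005.05142 = Acta Arith. 201 (2021): Lemma 1 (p. 5), its proof (§5, p. 15).
* E. T. Whittaker, G. N. Watson, *A Course of Modern Analysis*, §13.6 (Stirling for `log Γ`).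
-/

noncomputable section

open Complex Filter Set Asymptotics
open Literature.Analysis.SpecialFunctions

namespace Literature.NumberTheory.LFunctions

namespace DobnerLemma1

/-- Step A (one `Γ`-factor, `Re w > 0`, `|Im w| ≥ 1`; Stirling's formula as in the source,
p. 15: "`|Γ(z)| = exp(−(Im z) Arg z + O(|Im z|^{θ'}))`", here with an explicit error):
`|log ‖Γ(w)‖ + π|Im w|/2| ≤ (Re w + ½) log ‖w‖ + (π/2 + 1) Re w + 2`, from the tree's uniform
Stirling formula `GammaStirling.abs_log_norm_Gamma_sub_le` and
`GammaStirling.pi_mul_abs_div_two_sub_im_mul_arg_mem` (`0 ≤ π|u|/2 − u·arg w ≤ π Re w/2`).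
[cite: Dobner2021, Lemma 1 (proof, p. 15)] -/
theorem abs_log_norm_Gamma_add_le_of_re_pos {w : ℂ} (hre : 0 < w.re) (him : 1 ≤ |w.im|) :
    |Real.log ‖Complex.Gamma w‖ + Real.pi * |w.im| / 2| ≤
      (w.re + 1 / 2) * Real.log ‖w‖ + (Real.pi / 2 + 1) * w.re + 2 := by
  have hnorm1 : 1 ≤ ‖w‖ := him.trans (Complex.abs_im_le_norm w)
  have hnorm0 : 0 < ‖w‖ := by linarith
  have hlog0 : 0 ≤ Real.log ‖w‖ := Real.log_nonneg hnorm1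
  have hS := GammaStirling.abs_log_norm_Gamma_sub_le hre
  -- the Stirling remainder is `≤ 1`
  have hR : (1 / 12 : ℝ) * (1 / ‖w‖ ^ 2 + Real.pi / (2 * ‖w‖)) ≤ 1 := by
    have h1 : 1 / ‖w‖ ^ 2 ≤ 1 := by
      rw [div_le_one (by positivity)]
      nlinarith
    have h2 : Real.pi / (2 * ‖w‖) ≤ Real.pi / 2 := by
      apply div_le_div_of_nonneg_left Real.pi_pos.le (by norm_num)
      linarith
    have h3 : Real.pi < 4 := Real.pi_lt_four
    nlinarith
  -- the argument term: `0 ≤ π|u|/2 − u·arg w ≤ π x/2`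
  have hA := GammaStirling.pi_mul_abs_div_two_sub_im_mul_arg_mem (x := w.re) (u := w.im) hre
  rw [Complex.re_add_im] at hA
  obtain ⟨hA0, hA1⟩ := hA
  -- `|log (2π)/2| ≤ 1`
  have hc : |Real.log (2 * Real.pi) / 2| ≤ 1 := by
    have h2pi1 : 1 ≤ 2 * Real.pi := by linarith [Real.pi_gt_three]
    have hlog_nonneg : 0 ≤ Real.log (2 * Real.pi) := Real.log_nonneg h2pi1
    have hlog_le : Real.log (2 * Real.pi) ≤ 2 := by
      have h := Real.log_le_sub_one_of_pos (by linarith [Real.pi_gt_three] : (0 : ℝ) < 2 * Real.pi)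
      have : Real.log (2 * Real.pi) ≤ 2 * Real.pi - 1 := h
      have he : 2 * Real.pi ≤ Real.exp 2 := by
        have h1 := Real.exp_one_gt_d9
        have h2 : Real.exp 2 = Real.exp 1 * Real.exp 1 := by rw [← Real.exp_add]; norm_num
        have h3 : Real.pi < 3.15 := Real.pi_lt_d2
        nlinarith [Real.exp_pos (1 : ℝ)]
      calc Real.log (2 * Real.pi) ≤ Real.log (Real.exp 2) :=
            Real.log_le_log (by linarith [Real.pi_gt_three]) he
        _ = 2 := Real.log_exp 2
    rw [abs_le]
    constructor <;> linarith
  -- assemble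
  have habs_sub : |(w.re - 1 / 2) * Real.log ‖w‖| ≤ (w.re + 1 / 2) * Real.log ‖w‖ := by
    rw [abs_mul, abs_of_nonneg hlog0]
    apply mul_le_mul_of_nonneg_right _ hlog0
    rw [abs_le]; constructor <;> linarith
  have key : Real.log ‖Complex.Gamma w‖ + Real.pi * |w.im| / 2 =
      (Real.log ‖Complex.Gamma w‖ - ((w.re - 1 / 2) * Real.log ‖w‖ - w.im * Complex.arg w - w.re +
        Real.log (2 * Real.pi) / 2)) + (w.re - 1 / 2) * Real.log ‖w‖ +
        (Real.pi * |w.im| / 2 - w.im * Complex.arg w) - w.re + Real.log (2 * Real.pi) / 2 := by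
    ring
  rw [key]
  have hT1 := hS.trans hR
  calc _ ≤ |Real.log ‖Complex.Gamma w‖ - ((w.re - 1 / 2) * Real.log ‖w‖ - w.im * Complex.arg w -
          w.re + Real.log (2 * Real.pi) / 2)| + |(w.re - 1 / 2) * Real.log ‖w‖| +
          |Real.pi * |w.im| / 2 - w.im * Complex.arg w| + |w.re| + |Real.log (2 * Real.pi) / 2| := by
        have e1 := abs_add_le (Real.log ‖Complex.Gamma w‖ - ((w.re - 1 / 2) * Real.log ‖w‖ -
          w.im * Complex.arg w - w.re + Real.log (2 * Real.pi) / 2) + (w.re - 1 / 2) * Real.log ‖w‖ +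
          (Real.pi * |w.im| / 2 - w.im * Complex.arg w) - w.re) (Real.log (2 * Real.pi) / 2)
        have e2 := abs_sub (Real.log ‖Complex.Gamma w‖ - ((w.re - 1 / 2) * Real.log ‖w‖ -
          w.im * Complex.arg w - w.re + Real.log (2 * Real.pi) / 2) + (w.re - 1 / 2) * Real.log ‖w‖ +
          (Real.pi * |w.im| / 2 - w.im * Complex.arg w)) w.re
        have e3 := abs_add_le (Real.log ‖Complex.Gamma w‖ - ((w.re - 1 / 2) * Real.log ‖w‖ -
          w.im * Complex.arg w - w.re + Real.log (2 * Real.pi) / 2) + (w.re - 1 / 2) * Real.log ‖w‖)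
          (Real.pi * |w.im| / 2 - w.im * Complex.arg w)
        have e4 := abs_add_le (Real.log ‖Complex.Gamma w‖ - ((w.re - 1 / 2) * Real.log ‖w‖ -
          w.im * Complex.arg w - w.re + Real.log (2 * Real.pi) / 2)) ((w.re - 1 / 2) * Real.log ‖w‖)
        linarith
    _ ≤ 1 + (w.re + 1 / 2) * Real.log ‖w‖ + Real.pi * w.re / 2 + w.re + 1 := by
        have h4 : |Real.pi * |w.im| / 2 - w.im * Complex.arg w| ≤ Real.pi * w.re / 2 := by
          rw [abs_of_nonneg hA0]; exact hA1
        have h5 : |w.re| = w.re := abs_of_pos hre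
        linarith
    _ = (w.re + 1 / 2) * Real.log ‖w‖ + (Real.pi / 2 + 1) * w.re + 2 := by ring

/-- Step B (one `Γ`-factor, any real part, `|Im w| ≥ 1`): via the recurrence
`‖Γ(w)‖ = ‖Γ(w+n)‖/∏_{j<n}‖w+j‖` (`GammaStirling.norm_Gamma_eq_norm_Gamma_add_nat_div`) with
`n = ⌊|Re w|⌋ + 1` and Step A at `w + n`:
`|log ‖Γ(w)‖ + π|Im w|/2| ≤ (3|Re w| + 3) log(2|Re w| + 1 + |Im w|) + 6|Re w| + 5`.
[cite: Dobner2021, Lemma 1 (proof, p. 15)] -/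
theorem abs_log_norm_Gamma_add_le {w : ℂ} (him : 1 ≤ |w.im|) :
    |Real.log ‖Complex.Gamma w‖ + Real.pi * |w.im| / 2| ≤
      (3 * |w.re| + 3) * Real.log (2 * |w.re| + 1 + |w.im|) + 6 * |w.re| + 5 := by
  set X : ℝ := |w.re| with hX
  set t : ℝ := |w.im| with ht
  have hX0 : 0 ≤ X := abs_nonneg _
  have him0 : w.im ≠ 0 := by intro h; rw [ht, h, abs_zero] at him; linarith
  -- the shift
  set n : ℕ := ⌊X⌋₊ + 1 with hn
  have hnX : (n : ℝ) ≤ X + 1 := by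
    rw [hn]; push_cast; linarith [Nat.floor_le hX0]
  have hnX' : X < n := by rw [hn]; push_cast; exact Nat.lt_floor_add_one X
  set w' : ℂ := w + n with hw'
  have hw're : w'.re = w.re + n := by simp [hw']
  have hw'im : w'.im = w.im := by simp [hw']
  have hre' : 0 < w'.re := by
    rw [hw're]
    have : -X ≤ w.re := neg_abs_le _
    linarith
  have hre'le : w'.re ≤ 2 * X + 1 := by
    rw [hw're]; linarith [le_abs_self w.re]
  -- norms of `w + j`
  have hfac : ∀ j ∈ Finset.range n, t ≤ ‖w + (j : ℂ)‖ ∧ ‖w + (j : ℂ)‖ ≤ 2 * X + 1 + t := by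
    intro j hj
    have hj' : (j : ℝ) < n := by exact_mod_cast Finset.mem_range.1 hj
    constructor
    · have := Complex.abs_im_le_norm (w + j)
      simpa [ht] using this
    · calc ‖w + (j : ℂ)‖ ≤ |(w + (j : ℂ)).re| + |(w + (j : ℂ)).im| := Complex.norm_le_abs_re_add_abs_im _
        _ = |w.re + j| + t := by simp [ht]
        _ ≤ |w.re| + |(j : ℝ)| + t := by linarith [abs_add_le w.re (j : ℝ)]
        _ ≤ 2 * X + 1 + t := by
            rw [Nat.abs_cast]; linarith
  have ht1 : 1 ≤ t := him
  have hP0 : 0 < ∏ j ∈ Finset.range n, ‖w + (j : ℂ)‖ :=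
    Finset.prod_pos fun j hj ↦ lt_of_lt_of_le (by linarith) (hfac j hj).1
  have hΓ : ‖Complex.Gamma w‖ = ‖Complex.Gamma w'‖ / ∏ j ∈ Finset.range n, ‖w + (j : ℂ)‖ :=
    GammaStirling.norm_Gamma_eq_norm_Gamma_add_nat_div him0 n
  have hΓ'0 : 0 < ‖Complex.Gamma w'‖ :=
    norm_pos_iff.2 (Complex.Gamma_ne_zero_of_re_pos hre')
  have hlogΓ : Real.log ‖Complex.Gamma w‖ =
      Real.log ‖Complex.Gamma w'‖ - ∑ j ∈ Finset.range n, Real.log ‖w + (j : ℂ)‖ := by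
    rw [hΓ, Real.log_div hΓ'0.ne' hP0.ne', Real.log_prod]
    intro j hj
    exact (lt_of_lt_of_le (by linarith) (hfac j hj).1).ne'
  -- bounds on the sum of logs
  have hL : 0 ≤ Real.log (2 * X + 1 + t) := Real.log_nonneg (by linarith)
  have hsum_le : ∑ j ∈ Finset.range n, Real.log ‖w + (j : ℂ)‖ ≤ n * Real.log (2 * X + 1 + t) := by
    calc ∑ j ∈ Finset.range n, Real.log ‖w + (j : ℂ)‖
        ≤ ∑ j ∈ Finset.range n, Real.log (2 * X + 1 + t) :=
          Finset.sum_le_sum fun j hj ↦ Real.log_le_log (lt_of_lt_of_le (by linarith) (hfac j hj).1)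
            (hfac j hj).2
      _ = n * Real.log (2 * X + 1 + t) := by simp
  have hsum_ge : 0 ≤ ∑ j ∈ Finset.range n, Real.log ‖w + (j : ℂ)‖ :=
    Finset.sum_nonneg fun j hj ↦ Real.log_nonneg (ht1.trans (hfac j hj).1)
  -- Step A at `w'`
  have hA := abs_log_norm_Gamma_add_le_of_re_pos hre' (by rw [hw'im]; exact him)
  rw [hw'im] at hA
  have hnorm' : ‖w'‖ ≤ 2 * X + 1 + t := by
    calc ‖w'‖ ≤ |w'.re| + |w'.im| := Complex.norm_le_abs_re_add_abs_im _
      _ ≤ 2 * X + 1 + t := by rw [abs_of_pos hre', hw'im]; linarith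
  have hnorm'1 : 1 ≤ ‖w'‖ := by
    have := Complex.abs_im_le_norm w'
    rw [hw'im] at this
    linarith
  have hlogw' : Real.log ‖w'‖ ≤ Real.log (2 * X + 1 + t) :=
    Real.log_le_log (by linarith) hnorm'
  have hlogw'0 : 0 ≤ Real.log ‖w'‖ := Real.log_nonneg hnorm'1
  -- combine
  rw [hlogΓ]
  have e := abs_sub (Real.log ‖Complex.Gamma w'‖ + Real.pi * t / 2)
    (∑ j ∈ Finset.range n, Real.log ‖w + (j : ℂ)‖)
  have e' : |∑ j ∈ Finset.range n, Real.log ‖w + (j : ℂ)‖| ≤ (X + 1) * Real.log (2 * X + 1 + t) := by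
    rw [abs_of_nonneg hsum_ge]
    exact hsum_le.trans (mul_le_mul_of_nonneg_right hnX hL)
  have hA' : |Real.log ‖Complex.Gamma w'‖ + Real.pi * t / 2| ≤
      (2 * X + 3 / 2) * Real.log (2 * X + 1 + t) + (Real.pi / 2 + 1) * (2 * X + 1) + 2 := by
    refine hA.trans ?_
    have h1 : (w'.re + 1 / 2) * Real.log ‖w'‖ ≤ (2 * X + 3 / 2) * Real.log (2 * X + 1 + t) := by
      calc (w'.re + 1 / 2) * Real.log ‖w'‖ ≤ (2 * X + 3 / 2) * Real.log ‖w'‖ :=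
            mul_le_mul_of_nonneg_right (by linarith) hlogw'0
        _ ≤ (2 * X + 3 / 2) * Real.log (2 * X + 1 + t) :=
            mul_le_mul_of_nonneg_left hlogw' (by linarith)
    have h2 : (Real.pi / 2 + 1) * w'.re ≤ (Real.pi / 2 + 1) * (2 * X + 1) :=
      mul_le_mul_of_nonneg_left hre'le (by positivity)
    linarith
  have hring : Real.log ‖Complex.Gamma w'‖ - ∑ j ∈ Finset.range n, Real.log ‖w + (j : ℂ)‖ +
      Real.pi * t / 2 = (Real.log ‖Complex.Gamma w'‖ + Real.pi * t / 2) -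
        ∑ j ∈ Finset.range n, Real.log ‖w + (j : ℂ)‖ := by ring
  rw [hring]
  have hπ4 : Real.pi < 4 := Real.pi_lt_four
  nlinarith [e, e', hA', hL, hX0]


/-- `1 ≤ log τ` for `τ ≥ 3`. [folklore] -/
private theorem one_le_log_of_three_le {τ : ℝ} (hτ : 3 ≤ τ) : 1 ≤ Real.log τ := by
  rw [Real.le_log_iff_exp_le (by linarith)]
  have := Real.exp_one_lt_d9
  linarith

/-- Step C (one `Γ`-factor in a region `|Re w| ≤ X ≤ |Im w|`, `|Im w| ≥ 3`):
`|log ‖Γ(w)‖ + π|Im w|/2| ≤ 18 (X + 1) log |Im w|` — the source's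
"`exp(−C'|Im z|) ≤ |Γ(z)| ≤ exp(−C|Im z|)`" step with the error made explicit.
[cite: Dobner2021, Lemma 1 (proof, p. 15)] -/
theorem abs_log_norm_Gamma_add_le_of_le {w : ℂ} {X : ℝ} (hX : |w.re| ≤ X) (hXt : X ≤ |w.im|)
    (ht : 3 ≤ |w.im|) :
    |Real.log ‖Complex.Gamma w‖ + Real.pi * |w.im| / 2| ≤ 18 * (X + 1) * Real.log |w.im| := by
  set t : ℝ := |w.im| with ht_def
  have hX0 : 0 ≤ X := (abs_nonneg _).trans hX
  have hB := abs_log_norm_Gamma_add_le (w := w) (by linarith)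
  have hlogt : 1 ≤ Real.log t := one_le_log_of_three_le ht
  have hlog4t : Real.log (2 * |w.re| + 1 + t) ≤ 3 + Real.log t := by
    have h1 : 2 * |w.re| + 1 + t ≤ 4 * t := by linarith
    have h2 : Real.log (2 * |w.re| + 1 + t) ≤ Real.log (4 * t) :=
      Real.log_le_log (by linarith [abs_nonneg w.re]) h1
    have h3 : Real.log (4 * t) = Real.log 4 + Real.log t :=
      Real.log_mul (by norm_num) (by linarith)
    have h4 : Real.log 4 ≤ 3 := by
      have := Real.log_le_sub_one_of_pos (by norm_num : (0 : ℝ) < 4); linarith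
    linarith
  have hL0 : 0 ≤ Real.log (2 * |w.re| + 1 + t) := Real.log_nonneg (by linarith [abs_nonneg w.re])
  calc |Real.log ‖Complex.Gamma w‖ + Real.pi * t / 2|
      ≤ (3 * |w.re| + 3) * Real.log (2 * |w.re| + 1 + t) + 6 * |w.re| + 5 := hB
    _ ≤ (3 * X + 3) * (3 + Real.log t) + 6 * X + 5 := by
        have : (3 * |w.re| + 3) * Real.log (2 * |w.re| + 1 + t) ≤ (3 * X + 3) * (3 + Real.log t) :=
          mul_le_mul (by linarith) hlog4t hL0 (by linarith)
        linarith
    _ = (15 * X + 14) + (3 * X + 3) * Real.log t := by ring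
    _ ≤ (15 * X + 14) * Real.log t + (3 * X + 3) * Real.log t := by
        have : (15 * X + 14) * 1 ≤ (15 * X + 14) * Real.log t :=
          mul_le_mul_of_nonneg_left hlogt (by linarith)
        linarith
    _ ≤ 18 * (X + 1) * Real.log t := by nlinarith

/-- For `θ < 1` and `ε > 0`, eventually `A τ^θ log τ + B log τ + C ≤ ε τ`
(`log τ = o(τ^{1−θ})`). [folklore] -/
private theorem eventually_err_le {θ : ℝ} (hθ : θ < 1) (A B C : ℝ) {ε : ℝ} (hε : 0 < ε) :
    ∀ᶠ τ : ℝ in atTop, A * τ ^ θ * Real.log τ + B * Real.log τ + C ≤ ε * τ := by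
  have h1 : (fun τ : ℝ ↦ τ ^ θ * Real.log τ) =o[atTop] fun τ : ℝ ↦ τ := by
    have h := (isBigO_refl (fun τ : ℝ ↦ τ ^ θ) atTop).mul_isLittleO
      (isLittleO_log_rpow_atTop (sub_pos.2 hθ))
    refine h.congr' EventuallyEq.rfl ?_
    filter_upwards [eventually_gt_atTop 0] with τ hτ
    rw [← Real.rpow_add hτ, show θ + (1 - θ) = 1 by ring, Real.rpow_one]
  have h2 : (fun τ : ℝ ↦ Real.log τ) =o[atTop] fun τ : ℝ ↦ τ := Real.isLittleO_log_id_atTop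
  have h3 : (fun _ : ℝ ↦ C) =o[atTop] fun τ : ℝ ↦ τ := isLittleO_const_id_atTop C
  have h := ((h1.const_mul_left A).add (h2.const_mul_left B)).add h3
  have hb := h.def hε
  filter_upwards [hb, eventually_gt_atTop 0] with τ hτ hτ0
  rw [Real.norm_of_nonneg hτ0.le] at hτ
  have := le_abs_self (A * (τ ^ θ * Real.log τ) + B * Real.log τ + C)
  rw [← Real.norm_eq_abs] at this
  linarith


/-- `|a| - |b| ≤ |a + b|`. [folklore] -/
private theorem abs_sub_abs_le_abs_add (a b : ℝ) : |a| - |b| ≤ |a + b| := by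
  have := abs_add_le (a + b) (-b)
  simp only [add_neg_cancel_right, abs_neg] at this
  linarith

/-- Step D (the factor `Γ(ωᵢ s + μᵢ)` of `γ`, source p. 15: "Fix some `i` and let
`z := ωᵢ s + μᵢ`. Since `ωᵢ ∈ ℝ` and `|Im s|` is large, we have `|Im z| ≍ |Im s|` and
`|Re z| ≪ |Im z|^θ` … (eq:stirlingdecay)"): along `|Im s| = τ → ∞`, uniformly in
`|Re s| ≤ D τ^θ`, eventually `Γ(ω s + μ) ≠ 0` and `|log ‖Γ(ω s + μ)‖ + π ω τ/2| ≤ ε τ`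
(every `ε > 0`). [cite: Dobner2021, Lemma 1 (proof, p. 15, eq. (stirlingdecay))] -/
theorem eventually_gamma_factor {ω : ℝ} (hω : 0 < ω) (μ : ℂ) {D θ : ℝ} (hD : 0 ≤ D)
    (hθ : θ < 1) {ε : ℝ} (hε : 0 < ε) :
    ∀ᶠ τ : ℝ in atTop, ∀ s : ℂ, |s.im| = τ → |s.re| ≤ D * τ ^ θ →
      Complex.Gamma ((ω : ℂ) * s + μ) ≠ 0 ∧
      |Real.log ‖Complex.Gamma ((ω : ℂ) * s + μ)‖ + Real.pi * ω * τ / 2| ≤ ε * τ := by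
  set L₀ : ℝ := |Real.log (ω + ‖μ‖)| + 1 with hL₀
  have hL₀0 : 0 ≤ L₀ := by positivity
  filter_upwards [eventually_err_le hθ (18 * L₀ * ω * D) (18 * L₀ * (‖μ‖ + 1)) (Real.pi * ‖μ‖ / 2) hε,
    eventually_err_le hθ (ω * D) (2 * ‖μ‖) 0 hω, eventually_ge_atTop (3 : ℝ),
    eventually_ge_atTop ((3 + ‖μ‖) / ω)] with τ h1 h2 h3 h4
  intro s hsτ hsre
  set w : ℂ := (ω : ℂ) * s + μ with hw
  have hw_re : w.re = ω * s.re + μ.re := by simp [hw]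
  have hw_im : w.im = ω * s.im + μ.im := by simp [hw]
  have hlogτ : 1 ≤ Real.log τ := one_le_log_of_three_le h3
  have hτ1 : 1 ≤ τ := by linarith
  have hτθ0 : 0 ≤ τ ^ θ := Real.rpow_nonneg (by linarith) θ
  have hμre : |μ.re| ≤ ‖μ‖ := Complex.abs_re_le_norm μ
  have hμim : |μ.im| ≤ ‖μ‖ := Complex.abs_im_le_norm μ
  have hωτ : 3 + ‖μ‖ ≤ ω * τ := by
    have := (div_le_iff₀ hω).1 h4; linarith
  -- real and imaginary parts of `w`
  set X : ℝ := ω * D * τ ^ θ + ‖μ‖ with hX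
  have hXre : |w.re| ≤ X := by
    rw [hw_re]
    calc |ω * s.re + μ.re| ≤ |ω * s.re| + |μ.re| := abs_add_le _ _
      _ = ω * |s.re| + |μ.re| := by rw [abs_mul, abs_of_pos hω]
      _ ≤ ω * (D * τ ^ θ) + ‖μ‖ := by gcongr
      _ = X := by rw [hX]; ring
  have him_lo : ω * τ - ‖μ‖ ≤ |w.im| := by
    rw [hw_im]
    have h := abs_sub_abs_le_abs_add (ω * s.im) μ.im
    rw [abs_mul, abs_of_pos hω, hsτ] at h
    linarith
  have him_hi : |w.im| ≤ ω * τ + ‖μ‖ := by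
    rw [hw_im]
    calc |ω * s.im + μ.im| ≤ |ω * s.im| + |μ.im| := abs_add_le _ _
      _ = ω * τ + |μ.im| := by rw [abs_mul, abs_of_pos hω, hsτ]
      _ ≤ ω * τ + ‖μ‖ := by linarith
  have ht3 : 3 ≤ |w.im| := by linarith
  have hXt : X ≤ |w.im| := by
    -- from `h2 : ω D τ^θ log τ + 2‖μ‖ log τ + 0 ≤ ω τ`
    have e1 : ω * D * τ ^ θ ≤ ω * D * τ ^ θ * Real.log τ := by
      have : ω * D * τ ^ θ * 1 ≤ ω * D * τ ^ θ * Real.log τ :=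
        mul_le_mul_of_nonneg_left hlogτ (by positivity)
      linarith
    have e2 : 2 * ‖μ‖ ≤ 2 * ‖μ‖ * Real.log τ := by
      have : 2 * ‖μ‖ * 1 ≤ 2 * ‖μ‖ * Real.log τ :=
        mul_le_mul_of_nonneg_left hlogτ (by positivity)
      linarith
    rw [hX]; linarith
  -- no pole
  have hΓ0 : Complex.Gamma w ≠ 0 := by
    refine Complex.Gamma_ne_zero fun n hn ↦ ?_
    have := congrArg Complex.im hn
    simp only [Complex.neg_im, Complex.natCast_im, neg_zero] at this
    rw [this, abs_zero] at ht3
    linarith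
  refine ⟨hΓ0, ?_⟩
  -- Step C
  have hC := abs_log_norm_Gamma_add_le_of_le hXre hXt ht3
  have hlogim : Real.log |w.im| ≤ L₀ * Real.log τ := by
    have h5 : |w.im| ≤ (ω + ‖μ‖) * τ := by nlinarith [norm_nonneg μ]
    have h6 : Real.log |w.im| ≤ Real.log ((ω + ‖μ‖) * τ) := Real.log_le_log (by linarith) h5
    have h7 : Real.log ((ω + ‖μ‖) * τ) = Real.log (ω + ‖μ‖) + Real.log τ :=
      Real.log_mul (by positivity) (by linarith)
    have h8 : Real.log (ω + ‖μ‖) ≤ |Real.log (ω + ‖μ‖)| * Real.log τ := by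
      calc Real.log (ω + ‖μ‖) ≤ |Real.log (ω + ‖μ‖)| := le_abs_self _
        _ = |Real.log (ω + ‖μ‖)| * 1 := (mul_one _).symm
        _ ≤ |Real.log (ω + ‖μ‖)| * Real.log τ :=
            mul_le_mul_of_nonneg_left hlogτ (abs_nonneg _)
    rw [hL₀]; linarith
  have hX0 : 0 ≤ X := by positivity
  have hmain : |Real.log ‖Complex.Gamma w‖ + Real.pi * |w.im| / 2| ≤
      18 * L₀ * ω * D * τ ^ θ * Real.log τ + 18 * L₀ * (‖μ‖ + 1) * Real.log τ := by
    calc _ ≤ 18 * (X + 1) * Real.log |w.im| := hC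
      _ ≤ 18 * (X + 1) * (L₀ * Real.log τ) := mul_le_mul_of_nonneg_left hlogim (by positivity)
      _ = 18 * L₀ * ω * D * τ ^ θ * Real.log τ + 18 * L₀ * (‖μ‖ + 1) * Real.log τ := by
          rw [hX]; ring
  have hshift : |Real.pi * |w.im| / 2 - Real.pi * ω * τ / 2| ≤ Real.pi * ‖μ‖ / 2 := by
    rw [show Real.pi * |w.im| / 2 - Real.pi * ω * τ / 2 = Real.pi / 2 * (|w.im| - ω * τ) by ring,
      abs_mul, abs_of_pos (by positivity : (0 : ℝ) < Real.pi / 2)]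
    have : |(|w.im| - ω * τ)| ≤ ‖μ‖ := by rw [abs_le]; constructor <;> linarith
    nlinarith [Real.pi_pos]
  have hsplit : Real.log ‖Complex.Gamma w‖ + Real.pi * ω * τ / 2 =
      (Real.log ‖Complex.Gamma w‖ + Real.pi * |w.im| / 2) -
        (Real.pi * |w.im| / 2 - Real.pi * ω * τ / 2) := by ring
  rw [hsplit]
  have e := abs_sub (Real.log ‖Complex.Gamma w‖ + Real.pi * |w.im| / 2)
    (Real.pi * |w.im| / 2 - Real.pi * ω * τ / 2)
  linarith

/-- `τ^θ ≤ τ` for `τ ≥ 1`, `θ ≤ 1`. [folklore] -/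
private theorem rpow_le_self_of_one_le {τ θ : ℝ} (hτ : 1 ≤ τ) (hθ : θ ≤ 1) : τ ^ θ ≤ τ := by
  have := Real.rpow_le_rpow_of_exponent_le hτ hθ
  rwa [Real.rpow_one] at this

/-- Step E (source p. 15: "the polynomial and exponential factors in `γ(s)` are insignificant
because if `|Im s|` is large and `|Re s| ≤ D|Im s|^θ`, then
`exp(−|Im s|^{θ'}) ≤ |sᵐ(s−1)ᵐQˢ| ≤ exp(|Im s|^{θ'})`"): along `|Im s| = τ → ∞`, uniformly in
`|Re s| ≤ D τ^θ`, eventually `α sᵐ(s−1)ᵐ Qˢ ≠ 0` and `|log ‖α sᵐ (s−1)ᵐ Qˢ‖| ≤ ε τ`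
(every `ε > 0`). [cite: Dobner2021, Lemma 1 (proof, p. 15)] -/
theorem eventually_poly_factor {α : ℂ} (hα : α ≠ 0) (m : ℕ) {Q : ℝ} (hQ : 0 < Q) {D θ : ℝ}
    (hD : 0 ≤ D) (hθ : θ ≤ 1) (hθ1 : θ < 1) {ε : ℝ} (hε : 0 < ε) :
    ∀ᶠ τ : ℝ in atTop, ∀ s : ℂ, |s.im| = τ → |s.re| ≤ D * τ ^ θ →
      α * s ^ m * (s - 1) ^ m * (Q : ℂ) ^ s ≠ 0 ∧
      |Real.log ‖α * s ^ m * (s - 1) ^ m * (Q : ℂ) ^ s‖| ≤ ε * τ := by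
  filter_upwards [eventually_err_le hθ1 (D * |Real.log Q|) (2 * m)
    (|Real.log ‖α‖| + m * Real.log (D + 1) + m * Real.log (D + 2)) hε,
    eventually_ge_atTop (3 : ℝ)] with τ h1 h3
  intro s hsτ hsre
  have hlogτ : 1 ≤ Real.log τ := one_le_log_of_three_le h3
  have hτ1 : 1 ≤ τ := by linarith
  have hτθ0 : 0 ≤ τ ^ θ := Real.rpow_nonneg (by linarith) θ
  have hτθ : τ ^ θ ≤ τ := rpow_le_self_of_one_le hτ1 hθ
  have him0 : s.im ≠ 0 := by intro h; rw [h, abs_zero] at hsτ; linarith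
  have hs0 : s ≠ 0 := fun h ↦ him0 (by simp [h])
  have hs1 : s - 1 ≠ 0 := fun h ↦ him0 (by
    have := congrArg Complex.im h; simpa using this)
  have hQs : (Q : ℂ) ^ s ≠ 0 := by
    rw [Ne, Complex.cpow_eq_zero_iff, not_and_or]
    exact Or.inl (by exact_mod_cast hQ.ne')
  have hne : α * s ^ m * (s - 1) ^ m * (Q : ℂ) ^ s ≠ 0 :=
    mul_ne_zero (mul_ne_zero (mul_ne_zero hα (pow_ne_zero _ hs0)) (pow_ne_zero _ hs1)) hQs
  refine ⟨hne, ?_⟩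
  -- norms
  have hns_lo : τ ≤ ‖s‖ := hsτ ▸ Complex.abs_im_le_norm s
  have hns_hi : ‖s‖ ≤ (D + 1) * τ := by
    calc ‖s‖ ≤ |s.re| + |s.im| := Complex.norm_le_abs_re_add_abs_im s
      _ ≤ D * τ ^ θ + τ := by rw [hsτ]; linarith
      _ ≤ D * τ + τ := by nlinarith
      _ = (D + 1) * τ := by ring
  have hns1_lo : τ ≤ ‖s - 1‖ := by
    have := Complex.abs_im_le_norm (s - 1)
    simp only [Complex.sub_im, Complex.one_im, sub_zero] at this
    rwa [hsτ] at this
  have hns1_hi : ‖s - 1‖ ≤ (D + 2) * τ := by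
    calc ‖s - 1‖ ≤ |(s - 1).re| + |(s - 1).im| := Complex.norm_le_abs_re_add_abs_im _
      _ = |s.re - 1| + |s.im| := by simp
      _ ≤ |s.re| + 1 + τ := by rw [hsτ]; linarith [abs_sub s.re 1, abs_one (α := ℝ)]
      _ ≤ D * τ ^ θ + 1 + τ := by linarith
      _ ≤ D * τ + τ + τ := by nlinarith
      _ = (D + 2) * τ := by ring
  have hτ0 : 0 < τ := by linarith
  have hns0 : 0 < ‖s‖ := lt_of_lt_of_le hτ0 hns_lo
  have hns10 : 0 < ‖s - 1‖ := lt_of_lt_of_le hτ0 hns1_lo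
  have hnormQ : ‖(Q : ℂ) ^ s‖ = Q ^ s.re := Complex.norm_cpow_eq_rpow_re_of_pos hQ s
  have hlog : Real.log ‖α * s ^ m * (s - 1) ^ m * (Q : ℂ) ^ s‖ =
      Real.log ‖α‖ + m * Real.log ‖s‖ + m * Real.log ‖s - 1‖ + s.re * Real.log Q := by
    rw [norm_mul, norm_mul, norm_mul, norm_pow, norm_pow, hnormQ,
      Real.log_mul (by positivity) (by positivity), Real.log_mul (by positivity) (by positivity),
      Real.log_mul (by positivity) (by positivity), Real.log_pow, Real.log_pow,
      Real.log_rpow hQ]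
  rw [hlog]
  have hl1 : 0 ≤ Real.log ‖s‖ := Real.log_nonneg (hτ1.trans hns_lo)
  have hl1' : Real.log ‖s‖ ≤ Real.log (D + 1) + Real.log τ := by
    rw [← Real.log_mul (by positivity) hτ0.ne']
    exact Real.log_le_log hns0 hns_hi
  have hl2 : 0 ≤ Real.log ‖s - 1‖ := Real.log_nonneg (hτ1.trans hns1_lo)
  have hl2' : Real.log ‖s - 1‖ ≤ Real.log (D + 2) + Real.log τ := by
    rw [← Real.log_mul (by positivity) hτ0.ne']
    exact Real.log_le_log hns10 hns1_hi
  have hl3 : |s.re * Real.log Q| ≤ D * |Real.log Q| * τ ^ θ * Real.log τ := by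
    rw [abs_mul]
    calc |s.re| * |Real.log Q| ≤ D * τ ^ θ * |Real.log Q| :=
          mul_le_mul_of_nonneg_right hsre (abs_nonneg _)
      _ = D * |Real.log Q| * τ ^ θ * 1 := by ring
      _ ≤ D * |Real.log Q| * τ ^ θ * Real.log τ :=
          mul_le_mul_of_nonneg_left hlogτ (by positivity)
  have hm0 : (0 : ℝ) ≤ m := Nat.cast_nonneg m
  have hlD1 : 0 ≤ Real.log (D + 1) := Real.log_nonneg (by linarith)
  have hlD2 : 0 ≤ Real.log (D + 2) := Real.log_nonneg (by linarith)
  rw [abs_le]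
  constructor
  · have e1 : -|Real.log ‖α‖| ≤ Real.log ‖α‖ := neg_abs_le _
    have e2 : -(D * |Real.log Q| * τ ^ θ * Real.log τ) ≤ s.re * Real.log Q := (abs_le.1 hl3).1
    nlinarith
  · have e1 : Real.log ‖α‖ ≤ |Real.log ‖α‖| := le_abs_self _
    have e2 : s.re * Real.log Q ≤ D * |Real.log Q| * τ ^ θ * Real.log τ := (abs_le.1 hl3).2
    nlinarith


end DobnerLemma1

open DobnerLemma1 in
/-- **Discharge of `dobner_lemma1`** (Dobner 2021, Lemma 1, in the typed large-`|Im s|` form):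
for `γ(s) = α sᵐ(s−1)ᵐ Qˢ ∏ Γ(ωᵢ s + μᵢ)` with `α ≠ 0`, `Q > 0`, `k ≥ 1`, `ωᵢ > 0`, and
`D > 0`, `0 ≤ θ < 1`, there are `K, K', T₀ > 0` with
`exp(−K'|Im s|) ≤ |γ(s)| ≤ exp(−K|Im s|)` whenever `|Re s| ≤ D|Im s|^θ` and `|Im s| ≥ T₀`.
Proof as in the source (Stirling for each `Γ`-factor): `log |Γ(ωᵢ s + μᵢ)| = −(π/2)ωᵢ|Im s| +
O(|Im s|^θ log |Im s|)` uniformly in the region (the tree's uniform Stirling formula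
`GammaStirling.abs_log_norm_Gamma_sub_le` on `Re w > 0` plus the recurrence
`Γ(w) = Γ(w+n)/∏(w+j)` for `Re w ≤ 0`), the polynomial and exponential factors contribute
`O(|Im s|^θ log |Im s|)`, so `log |γ(s)| = −W|Im s| + o(|Im s|)` with `W = (π/2)∑ωᵢ > 0`;
`K = W/2`, `K' = 3W/2`. (CONTENT discharge; `Re μᵢ ≥ 0` is not needed for large `|Im s|`.)
[cite: Dobner2021, Lemma 1] -/
theorem dobner_lemma1_holds : dobner_lemma1 := by
  intro α m Q k ω μ hα hQ hk hω _hμ D θ hD hθ0 hθ1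
  -- the decay rate
  set W : ℝ := Real.pi / 2 * ∑ i, ω i with hW
  have hsum : 0 < ∑ i, ω i := by
    haveI : Nonempty (Fin k) := ⟨⟨0, hk⟩⟩
    exact Finset.sum_pos (fun i _ ↦ hω i) Finset.univ_nonempty
  have hW0 : 0 < W := by positivity
  set ε : ℝ := W / (2 * (k + 1)) with hε
  have hε0 : 0 < ε := by positivity
  -- the eventual bounds, uniformly in the region
  have hG : ∀ i : Fin k, ∀ᶠ τ : ℝ in atTop, ∀ s : ℂ, |s.im| = τ → |s.re| ≤ D * τ ^ θ →
      Complex.Gamma ((ω i : ℂ) * s + μ i) ≠ 0 ∧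
      |Real.log ‖Complex.Gamma ((ω i : ℂ) * s + μ i)‖ + Real.pi * ω i * τ / 2| ≤ ε * τ :=
    fun i ↦ eventually_gamma_factor (hω i) (μ i) hD.le hθ1 hε0
  have hP := eventually_poly_factor hα m hQ hD.le hθ1.le hθ1 hε0
  obtain ⟨T₀, hT₀⟩ := Filter.eventually_atTop.1 ((eventually_all.2 hG).and hP)
  refine ⟨W / 2, 3 * W / 2, max T₀ 1, by positivity, by positivity, fun s hs hT ↦ ?_⟩
  set τ : ℝ := |s.im| with hτ
  have hT' : T₀ ≤ τ := le_trans (le_max_left _ _) hT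
  have hτ0 : 0 < τ := lt_of_lt_of_le one_pos (le_trans (le_max_right _ _) hT)
  obtain ⟨hGall, hPs⟩ := hT₀ τ hT'
  have hG1 := fun i ↦ hGall i s rfl hs
  obtain ⟨hP0, hP1⟩ := hPs s rfl hs
  -- `log ‖γ s‖ = log ‖poly‖ + Σ log ‖Γᵢ‖`
  have hprod0 : ∏ i, Complex.Gamma ((ω i : ℂ) * s + μ i) ≠ 0 :=
    Finset.prod_ne_zero_iff.2 fun i _ ↦ (hG1 i).1
  have hγ : dobnerGamma α m Q ω μ s =
      (α * s ^ m * (s - 1) ^ m * (Q : ℂ) ^ s) * ∏ i, Complex.Gamma ((ω i : ℂ) * s + μ i) := rfl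
  have hγ0 : dobnerGamma α m Q ω μ s ≠ 0 := by rw [hγ]; exact mul_ne_zero hP0 hprod0
  have hlog : Real.log ‖dobnerGamma α m Q ω μ s‖ =
      Real.log ‖α * s ^ m * (s - 1) ^ m * (Q : ℂ) ^ s‖ +
        ∑ i, Real.log ‖Complex.Gamma ((ω i : ℂ) * s + μ i)‖ := by
    rw [hγ, norm_mul, Real.log_mul (norm_ne_zero_iff.2 hP0) (norm_ne_zero_iff.2 hprod0), norm_prod,
      Real.log_prod]
    intro i _
    exact norm_ne_zero_iff.2 (hG1 i).1
  -- the error estimate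
  have hWτ : ∑ i, Real.pi * ω i * τ / 2 = W * τ := by
    rw [hW, Finset.mul_sum, Finset.sum_mul]
    refine Finset.sum_congr rfl fun i _ ↦ by ring
  have herr : |Real.log ‖dobnerGamma α m Q ω μ s‖ + W * τ| ≤ W / 2 * τ := by
    rw [hlog, ← hWτ, add_assoc, ← Finset.sum_add_distrib]
    calc _ ≤ |Real.log ‖α * s ^ m * (s - 1) ^ m * (Q : ℂ) ^ s‖| +
          |∑ i, (Real.log ‖Complex.Gamma ((ω i : ℂ) * s + μ i)‖ + Real.pi * ω i * τ / 2)| :=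
          abs_add_le _ _
      _ ≤ ε * τ + ∑ i : Fin k, ε * τ :=
          add_le_add hP1
            ((Finset.abs_sum_le_sum_abs _ _).trans (Finset.sum_le_sum fun i _ ↦ (hG1 i).2))
      _ = (k + 1) * ε * τ := by
          rw [Finset.sum_const, Finset.card_univ, Fintype.card_fin, nsmul_eq_mul]; ring
      _ = W / 2 * τ := by rw [hε]; field_simp
  -- conclude
  have hpos : 0 < ‖dobnerGamma α m Q ω μ s‖ := norm_pos_iff.2 hγ0
  rw [← Real.exp_log hpos]
  obtain ⟨e1, e2⟩ := abs_le.1 herr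
  constructor
  · apply Real.exp_le_exp.2; linarith
  · apply Real.exp_le_exp.2; linarith

end Literature.NumberTheory.LFunctions

end
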